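import Mathlib
import HarnessLib
import Summits.Ventures.LatticeQCDFlow.StatementClustering
import Summits.Ventures.LatticeQCDFlow.Scaling.CorrelatorFloorTwoDim

/-!
# Venture statement — LatticeQCDFlow — DRAFT, Part S20: THE VOLUME-LAW HYPOTHESES (U′) AND (U″)
# ARE FALSE IN TWO DIMENSIONS FOR EVERY COMPACT GAUGE GROUP (lean-1 row 30, GEN-13; chain-completed and
# filed by lean-1 GEN-20 per LEAD LINE 411 — WAKE v75-thaw, theory2 v7.5)

HONEST FRAMING: exact (Metropolis-corrected) sampling algorithms for lattice gauge theory;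
figures of merit are autocorrelation/cost numbers at stated couplings and volumes; no
continuum-physics claim.

`Statement*.lean` is FROZEN through Mon 2026-08-25T09:00Z (LEAD LINE 234 (iv)); this draft is STAGED
in `HOME/lean-1/thaw/` next to GEN-12's `StatementClustering.lean` (Parts S15–S19) for the thaw-day
lead and theory2 to word / number / trim / file — it is NOT a proposal.  One typed `Prop` over the
landed substrate with its `_holds` discharge:

* **S20 ((U′) AND (U″) ARE FALSE IN TWO DIMENSIONS, EVERY COMPACT GAUGE GROUP)** (lean-1 GEN-13,
  `Scaling/CorrelatorFloorTwoDim.lean` over `Scaling/PlaquetteDecorrelationTwoDim.lean` /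
  `Scaling/WilsonPairCovarianceTwoDim.lean`): for every compact second-countable `G`, every continuous
  `ρ : G →* M_N(ℂ)`, every real `β`, every cut width `R`, every plane `i ≠ j` of `(ℤ/L)²` and every axis
  `a`: `¬ Conjectures.CrossCutCorrelatorFloor 2 N G ρ β R i j a` and `¬ Conjectures.ClusteringFloor 2 N G ρ β i j a`
  — any two plaquette observables of the two-dimensional torus Wilson measure decorrelate as the volume
  grows, uniformly in their positions (`Theory2.Lattice.TwoDim.wilson_plaquette_pair_decorrelation`), so no
  volume-uniform floor exists; the dimension guard `3 ≤ d` of the repaired items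
  (`Scaling/ConjecturesRepaired.lean`) is therefore necessary.

If the lead conjoins it: `TheoryStatementS20 := TheoryStatementS19 ∧ S20_TwoDimNoFloor` (S19 = GEN-12's
draft).  What is NOT claimed: anything in `d ≥ 3`; discontinuous `ρ`.  Nothing numerical is asserted;
no `sorry`; the only new `def` is the `Prop` of record.
-/

noncomputable section

namespace Summit.Ventures.LatticeQCDFlow

/-! ### Part S, appended — S20 (lean-1 GEN-13) -/

/-- **S20 ((U′) AND (U″) ARE FALSE IN TWO DIMENSIONS).**  For every compact second-countable `G`,
continuous `ρ`, real `β`, `R`, plane `i ≠ j` of `Fin 2` and axis `a`: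
`¬ CrossCutCorrelatorFloor 2 N G ρ β R i j a ∧ ¬ ClusteringFloor 2 N G ρ β i j a`.
PROVED: `Theory2.Lattice.TwoDim.not_crossCutCorrelatorFloor_two`, `not_clusteringFloor_two` (lean-1 GEN-13). -/
def S20_TwoDimNoFloor : Prop :=
  ∀ (N : ℕ) (G : Type) [Group G] [TopologicalSpace G] [IsTopologicalGroup G] [CompactSpace G]
    [MeasurableSpace G] [BorelSpace G] [SecondCountableTopology G]
    (ρ : G →* Matrix (Fin N) (Fin N) ℂ), Continuous ρ → ∀ (β : ℝ) (R : ℕ) (i j a : Fin 2), i ≠ j →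
      ¬ Conjectures.CrossCutCorrelatorFloor 2 N G ρ β R i j a ∧
        ¬ Conjectures.ClusteringFloor 2 N G ρ β i j a

/-- S20 holds. -/
theorem S20_TwoDimNoFloor_holds : S20_TwoDimNoFloor :=
  fun _ _ _ _ _ _ _ _ _ ρ hρ β R _ _ a hij =>
    ⟨Theory2.Lattice.TwoDim.not_crossCutCorrelatorFloor_two ρ hρ β R hij a,
      Theory2.Lattice.TwoDim.not_clusteringFloor_two ρ hρ β hij a⟩

/-- **The venture's theory statement through Part S20** (LEAD LINE 411 CHAIN RULE): everything through
S19 (`StatementClustering`) and the two-dimensional no-go S20. -/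
def TheoryStatementS20 : Prop :=
  TheoryStatementS19 ∧ S20_TwoDimNoFloor

/-- The statement through S20 holds. -/
theorem TheoryStatementS20_holds : TheoryStatementS20 :=
  ⟨TheoryStatementS19_holds, S20_TwoDimNoFloor_holds⟩

end Summit.Ventures.LatticeQCDFlow

end
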